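import Mathlib
import Summits.RiemannHypothesis.RiemannHypothesis.Theorems.SoloInformedMollifier
import Literature.NumberTheory.LFunctions.WeilGroundEnergyProofs
import Literature.NumberTheory.LFunctions.WeilLineSupSamplingPrelim
import Literature.NumberTheory.LFunctions.WeilWindowSuzukiContinuityProofs
import HarnessLib

/-!
# T42b — The high part of the verified-height split

Solo programme `solo-RiemannHypothesis-informed`, claim T42, part (b).  For a test function `g`
with `tsupport g ⊆ [-a, a]` and a mollifier profile `ψ` of radius `δ` (T42a) split the
autocorrelation `K = g ⋆ g̃` as `K = K ⋆ φ + (K - K ⋆ φ)` with `φ = ψc ⋆ ψ̃c`.  This file treats the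
HIGH PART `G₂ = K - K ⋆ φ` on the PRIME side of the explicit formula, i.e. by the definition of the
Weil functional `W = polar - prime + arch`:

* `Ĝ₂(1/2 + it) = |ĝ(1/2+it)|² (1 - |ψ̂(1/2+it)|²) =: u(t) ≥ 0` (`weilMellin_highPart_half_line`), so
  by Mellin inversion `‖G₂(x)‖ ≤ (2π)⁻¹ ∫ u =: M₂` for all `x` (`norm_highPart_le`); hence the prime
  term is at most `2 M₂ S(2a+2δ)`, `S(b) = Σ_{n ≤ e^b} Λ(n)/√n` (`norm_weilPrimeTerm_highPart_le`),
  and `-Re G₂(0) log π ≥ -M₂ log π`;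
* the archimedean integral is `∫ u(t) Re ψ(1/4 + it/2) dt ≥ W_h ∫ u - (W_h - ψ(1/4)) ∫_{|t|<|h|} u`
  (step minorant, `integral_mul_reDigammaQuarter_ge_step`) and `∫_{|t|<|h|} u ≤ δ²h² · 2π‖g‖₂²`
  by the low-height transparency of the mollifier (`setIntegral_highDensity_le`);
* the polar term is at most `2(e^δ - 1) e^a ‖g‖₁²` (`norm_weilPolarTerm_highPart_le`).

Choosing `h` with `Re ψ(1/4 + ih/2) ≥ log π + 2 S(2a + 2δ)` the `M₂`-terms have a non-negative
total and drop out (`weilFunctional_highPart_re_ge`):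
`Re W(G₂) ≥ -(W_h - ψ(1/4)) δ² h² ‖g‖₂² - 2 (e^δ - 1) e^a ‖g‖₁²`.
No hypothesis on the zeros of `ζ` is used here.
-/

open scoped ContDiff ComplexConjugate ArithmeticFunction.vonMangoldt Real Pointwise
open Complex MeasureTheory Set Filter Literature.NumberTheory.LFunctions
  Literature.Analysis.SpecialFunctions

namespace Summit.RiemannHypothesis.RiemannHypothesis.Theorems

/-- The autocorrelation `K = g ⋆ g̃`. -/
noncomputable def autoCorr (g : ℝ → ℂ) : ℝ → ℂ := weilConv g (weilReflect g)

/-- The low part `G₁ = K ⋆ φ`. -/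
noncomputable def lowPart (g : ℝ → ℂ) (ψ : ℝ → ℝ) : ℝ → ℂ := weilConv (autoCorr g) (mollKernel ψ)

/-- The high part `G₂ = K - K ⋆ φ`. -/
noncomputable def highPart (g : ℝ → ℂ) (ψ : ℝ → ℝ) : ℝ → ℂ := autoCorr g - lowPart g ψ

/-- The spectral density of the high part on the critical line,
`u(t) = |ĝ(1/2+it)|² (1 - |ψ̂c(1/2+it)|²)`. -/
noncomputable def highDensity (g : ℝ → ℂ) (ψ : ℝ → ℝ) (t : ℝ) : ℝ :=
  ‖weilMellin g (1 / 2 + t * I)‖ ^ 2 * (1 - ‖weilMellin (mollC ψ) (1 / 2 + t * I)‖ ^ 2)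

/-- The high mass `M₂ = (2π)⁻¹ ∫ u`. -/
noncomputable def highMass (g : ℝ → ℂ) (ψ : ℝ → ℝ) : ℝ := (2 * π)⁻¹ * ∫ t, highDensity g ψ t

/-- The prime sum `S(b) = Σ_{n ≤ e^b} Λ(n)/√n`. -/
noncomputable def primeSum (b : ℝ) : ℝ :=
  ∑ n ∈ Finset.range (⌊Real.exp b⌋₊ + 1), (Λ n : ℝ) / Real.sqrt n

/-- `S(b) ≥ 0`. -/
theorem primeSum_nonneg (b : ℝ) : 0 ≤ primeSum b :=
  Finset.sum_nonneg fun _ _ ↦ div_nonneg ArithmeticFunction.vonMangoldt_nonneg (Real.sqrt_nonneg _)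

variable {g : ℝ → ℂ} {ψ : ℝ → ℝ} {a δ : ℝ}

/-! ## Test-function bookkeeping -/

/-- `K` is a test function. -/
theorem isWeilTest_autoCorr (hg : IsWeilTest g) : IsWeilTest (autoCorr g) :=
  hg.weilConv hg.weilReflect

/-- `G₁` is a test function. -/
theorem isWeilTest_lowPart (hg : IsWeilTest g) (hψ : IsMollifier ψ δ) : IsWeilTest (lowPart g ψ) :=
  (isWeilTest_autoCorr hg).weilConv hψ.isWeilTest_mollKernel

/-- `G₂` is a test function. -/
theorem isWeilTest_highPart (hg : IsWeilTest g) (hψ : IsMollifier ψ δ) :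
    IsWeilTest (highPart g ψ) :=
  (isWeilTest_autoCorr hg).sub (isWeilTest_lowPart hg hψ)

/-- `K = G₁ + G₂`. -/
theorem lowPart_add_highPart (g : ℝ → ℂ) (ψ : ℝ → ℝ) :
    lowPart g ψ + highPart g ψ = autoCorr g := by
  unfold highPart; abel

/-- `tsupport K ⊆ [-2a, 2a]`. -/
theorem tsupport_autoCorr_subset (hg : IsWeilTest g) (hsupp : tsupport g ⊆ Icc (-a) a) :
    tsupport (autoCorr g) ⊆ Icc (-(2 * a)) (2 * a) :=
  tsupport_weilConv_weilReflect_subset hg.2 hsupp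

/-- `Icc (-b) b + Icc (-c) c ⊆ Icc (-(b + c)) (b + c)`. -/
theorem Icc_add_Icc_subset (b c : ℝ) :
    Icc (-b) b + Icc (-c) c ⊆ Icc (-(b + c)) (b + c) := by
  rintro x ⟨y, hy, z, hz, rfl⟩
  simp only [mem_Icc] at hy hz ⊢
  constructor <;> linarith [hy.1, hy.2, hz.1, hz.2]

/-- `tsupport G₁ ⊆ [-(2a+2δ), 2a+2δ]`. -/
theorem tsupport_lowPart_subset (hg : IsWeilTest g) (hsupp : tsupport g ⊆ Icc (-a) a)
    (hψ : IsMollifier ψ δ) :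
    tsupport (lowPart g ψ) ⊆ Icc (-(2 * a + 2 * δ)) (2 * a + 2 * δ) :=
  (tsupport_weilConv_subset (isWeilTest_autoCorr hg).2).trans
    ((add_subset_add (tsupport_autoCorr_subset hg hsupp) hψ.tsupport_mollKernel_subset).trans
      (Icc_add_Icc_subset _ _))

/-- `tsupport G₂ ⊆ [-(2a+2δ), 2a+2δ]`. -/
theorem tsupport_highPart_subset (hg : IsWeilTest g) (hsupp : tsupport g ⊆ Icc (-a) a)
    (hψ : IsMollifier ψ δ) :
    tsupport (highPart g ψ) ⊆ Icc (-(2 * a + 2 * δ)) (2 * a + 2 * δ) := by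
  have hδ := hψ.radius_nonneg
  have hK : tsupport (autoCorr g) ⊆ Icc (-(2 * a + 2 * δ)) (2 * a + 2 * δ) :=
    (tsupport_autoCorr_subset hg hsupp).trans (Icc_subset_Icc (by linarith) (by linarith))
  have hL := tsupport_lowPart_subset hg hsupp hψ
  unfold highPart
  refine closure_minimal ?_ isClosed_Icc
  exact (Function.support_sub _ _).trans
    (union_subset ((subset_tsupport _).trans hK) ((subset_tsupport _).trans hL))

/-! ## The transform of the high part -/

/-- `Ĝ₂(s) = K̂(s) (1 - φ̂(s))`. -/
theorem weilMellin_highPart (hg : IsWeilTest g) (hψ : IsMollifier ψ δ) (s : ℂ) :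
    weilMellin (highPart g ψ) s =
      weilMellin (autoCorr g) s * (1 - weilMellin (mollKernel ψ) s) := by
  have hK := isWeilTest_autoCorr hg
  have hφ := hψ.isWeilTest_mollKernel
  unfold highPart lowPart
  rw [weilMellin_sub hK.1.continuous hK.2 (hK.weilConv hφ).1.continuous (hK.weilConv hφ).2,
    weilMellin_weilConv_holds hK.1.continuous hK.2 hφ.1.continuous hφ.2]
  ring

/-- On the critical line `Ĝ₂(1/2 + it) = u(t)`. -/
theorem weilMellin_highPart_half_line (hg : IsWeilTest g) (hψ : IsMollifier ψ δ) (t : ℝ) :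
    weilMellin (highPart g ψ) (1 / 2 + t * I) = ((highDensity g ψ t : ℝ) : ℂ) := by
  rw [weilMellin_highPart hg hψ, autoCorr, weilMellin_weilConv_weilReflect_half hg,
    hψ.weilMellin_mollKernel_half_line, highDensity]
  push_cast
  ring

/-- `0 ≤ u(t) ≤ |ĝ(1/2+it)|²`. -/
theorem highDensity_bounds (hψ : IsMollifier ψ δ) (g : ℝ → ℂ) (t : ℝ) :
    0 ≤ highDensity g ψ t ∧ highDensity g ψ t ≤ ‖weilMellin g (1 / 2 + t * I)‖ ^ 2 := by
  obtain ⟨h0, h1, -⟩ := hψ.mollKernel_half_line_bounds t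
  unfold highDensity
  constructor
  · exact mul_nonneg (sq_nonneg _) (by linarith)
  · nlinarith [sq_nonneg ‖weilMellin g (1 / 2 + t * I)‖]

/-- `u` is continuous. -/
theorem continuous_highDensity (hg : IsWeilTest g) (hψ : IsMollifier ψ δ) :
    Continuous (highDensity g ψ) :=
  (continuous_norm_sq_weilMellin_half_line hg).mul
    (continuous_const.sub (continuous_norm_sq_weilMellin_half_line hψ.isWeilTest))

/-- `u` is integrable. -/
theorem integrable_highDensity (hg : IsWeilTest g) (hψ : IsMollifier ψ δ) :
    Integrable (highDensity g ψ) :=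
  (integrable_norm_sq_weilMellin_half_line hg).mono'
    (continuous_highDensity hg hψ).aestronglyMeasurable
    (Eventually.of_forall fun t ↦ by
      rw [Real.norm_of_nonneg (highDensity_bounds hψ g t).1]
      exact (highDensity_bounds hψ g t).2)

/-- `u · Re ψ(1/4 + i·/2)` is integrable. -/
theorem integrable_highDensity_mul_reDigammaQuarter (hg : IsWeilTest g) (hψ : IsMollifier ψ δ) :
    Integrable fun t ↦ highDensity g ψ t * reDigammaQuarter t :=
  (integrable_norm_sq_weilMellin_mul_reDigammaQuarter hg).mono
    ((continuous_highDensity hg hψ).aestronglyMeasurable.mul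
      measurable_reDigammaQuarter.aestronglyMeasurable)
    (Eventually.of_forall fun t ↦ by
      rw [norm_mul, Real.norm_of_nonneg (highDensity_bounds hψ g t).1, Real.norm_eq_abs]
      calc highDensity g ψ t * |reDigammaQuarter t|
          ≤ ‖weilMellin g (1 / 2 + t * I)‖ ^ 2 * |reDigammaQuarter t| :=
            mul_le_mul_of_nonneg_right (highDensity_bounds hψ g t).2 (abs_nonneg _)
        _ ≤ ‖‖weilMellin g (1 / 2 + t * I)‖ ^ 2 * reDigammaQuarter t‖ := by
            rw [norm_mul, Real.norm_of_nonneg (sq_nonneg _), Real.norm_eq_abs])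

/-- `M₂ ≥ 0`. -/
theorem highMass_nonneg (hψ : IsMollifier ψ δ) (g : ℝ → ℂ) : 0 ≤ highMass g ψ :=
  mul_nonneg (by positivity) (integral_nonneg fun t ↦ (highDensity_bounds hψ g t).1)

/-- **Sup bound by inversion.** `‖G₂(x)‖ ≤ M₂` for every `x`. -/
theorem norm_highPart_le (hg : IsWeilTest g) (hψ : IsMollifier ψ δ) (x : ℝ) :
    ‖highPart g ψ x‖ ≤ highMass g ψ := by
  unfold highMass
  exact norm_le_of_norm_weilMellin_line_le (isWeilTest_highPart hg hψ)
    (integrable_highDensity hg hψ) (fun y ↦ by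
      rw [weilMellin_highPart_half_line hg hψ, Complex.norm_real,
        Real.norm_of_nonneg (highDensity_bounds hψ g y).1]) x

/-! ## The three terms of `W(G₂)` -/

/-- **Prime term.** `‖prime(G₂)‖ ≤ 2 M₂ S(2a + 2δ)`. -/
theorem norm_weilPrimeTerm_highPart_le (hg : IsWeilTest g) (hsupp : tsupport g ⊆ Icc (-a) a)
    (hψ : IsMollifier ψ δ) :
    ‖weilPrimeTerm (highPart g ψ)‖ ≤ 2 * highMass g ψ * primeSum (2 * a + 2 * δ) :=
  norm_weilPrimeTerm_le_of_tsupport_subset (isWeilTest_highPart hg hψ).1.continuous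
    (tsupport_highPart_subset hg hsupp hψ) (norm_highPart_le hg hψ)

/-- `‖K̂(σ)‖ ≤ e^a ‖g‖₁²` at `σ = 0` and `σ = 1`. -/
theorem norm_weilMellin_autoCorr_le (hg : IsWeilTest g) (hsupp : tsupport g ⊆ Icc (-a) a)
    {s : ℂ} (hs : s = 0 ∨ s = 1) :
    ‖weilMellin (autoCorr g) s‖ ≤ Real.exp a * weilNorm1 g ^ 2 := by
  have h0 : ‖weilMellin g 0‖ ≤ Real.exp (1 / 2 * a) * weilNorm1 g := by
    have := norm_weilMellin_add_half_le hg hsupp (-1 / 2)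
    norm_num at this
    exact this
  have h1 : ‖weilMellin g 1‖ ≤ Real.exp (1 / 2 * a) * weilNorm1 g := by
    have := norm_weilMellin_add_half_le hg hsupp (1 / 2)
    norm_num at this
    exact this
  have hN := weilNorm1_nonneg g
  have he : Real.exp (1 / 2 * a) * Real.exp (1 / 2 * a) = Real.exp a := by
    rw [← Real.exp_add]; ring_nf
  unfold autoCorr
  rw [weilMellin_weilQuadratic hg, norm_mul, Complex.norm_conj]
  rcases hs with rfl | rfl
  · simp only [map_zero, sub_zero]
    calc ‖weilMellin g 0‖ * ‖weilMellin g 1‖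
        ≤ (Real.exp (1 / 2 * a) * weilNorm1 g) * (Real.exp (1 / 2 * a) * weilNorm1 g) :=
          mul_le_mul h0 h1 (norm_nonneg _) (by positivity)
      _ = Real.exp a * weilNorm1 g ^ 2 := by rw [← he]; ring
  · simp only [map_one, sub_self]
    calc ‖weilMellin g 1‖ * ‖weilMellin g 0‖
        ≤ (Real.exp (1 / 2 * a) * weilNorm1 g) * (Real.exp (1 / 2 * a) * weilNorm1 g) :=
          mul_le_mul h1 h0 (norm_nonneg _) (by positivity)
      _ = Real.exp a * weilNorm1 g ^ 2 := by rw [← he]; ring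

/-- **Polar term.** `‖polar(G₂)‖ ≤ 2 (e^δ - 1) e^a ‖g‖₁²`. -/
theorem norm_weilPolarTerm_highPart_le (hg : IsWeilTest g) (hsupp : tsupport g ⊆ Icc (-a) a)
    (hψ : IsMollifier ψ δ) :
    ‖weilPolarTerm (highPart g ψ)‖ ≤
      2 * (Real.exp δ - 1) * (Real.exp a * weilNorm1 g ^ 2) := by
  unfold weilPolarTerm
  rw [weilMellin_highPart hg hψ, weilMellin_highPart hg hψ]
  have hA0 := norm_weilMellin_autoCorr_le hg hsupp (s := 0) (Or.inl rfl)
  have hA1 := norm_weilMellin_autoCorr_le hg hsupp (s := 1) (Or.inr rfl)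
  have hB0 := hψ.norm_one_sub_weilMellin_mollKernel_zero_le
  have hB1 := hψ.norm_one_sub_weilMellin_mollKernel_one_le
  have hE : 0 ≤ Real.exp a * weilNorm1 g ^ 2 := by positivity
  calc ‖weilMellin (autoCorr g) 0 * (1 - weilMellin (mollKernel ψ) 0) +
        weilMellin (autoCorr g) 1 * (1 - weilMellin (mollKernel ψ) 1)‖
      ≤ ‖weilMellin (autoCorr g) 0‖ * ‖1 - weilMellin (mollKernel ψ) 0‖ +
        ‖weilMellin (autoCorr g) 1‖ * ‖1 - weilMellin (mollKernel ψ) 1‖ := by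
        refine (norm_add_le _ _).trans ?_
        rw [norm_mul, norm_mul]
    _ ≤ (Real.exp a * weilNorm1 g ^ 2) * (Real.exp δ - 1) +
        (Real.exp a * weilNorm1 g ^ 2) * (Real.exp δ - 1) :=
        add_le_add (mul_le_mul hA0 hB0 (norm_nonneg _) hE) (mul_le_mul hA1 hB1 (norm_nonneg _) hE)
    _ = 2 * (Real.exp δ - 1) * (Real.exp a * weilNorm1 g ^ 2) := by ring

/-- **Step minorant.** For a non-negative integrable `u` with `u · Re ψ` integrable and every `h`:
`W_h ∫ u - (W_h - ψ(1/4)) ∫_{|t|<|h|} u ≤ ∫ u(t) Re ψ(1/4 + it/2) dt`, `W_h = Re ψ(1/4 + ih/2)`. -/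
theorem integral_mul_reDigammaQuarter_ge_step {u : ℝ → ℝ} (hu0 : ∀ t, 0 ≤ u t)
    (hui : Integrable u) (huR : Integrable fun t ↦ u t * reDigammaQuarter t) (h : ℝ) :
    reDigammaQuarter h * (∫ t, u t) -
        (reDigammaQuarter h - reDigammaQuarter 0) * (∫ t in Ioo (-|h|) |h|, u t) ≤
      ∫ t, u t * reDigammaQuarter t := by
  set W : ℝ := reDigammaQuarter h with hW
  set w₀ : ℝ := reDigammaQuarter 0 with hw₀
  set E : Set ℝ := Ioo (-|h|) |h| with hE
  have hEm : MeasurableSet E := measurableSet_Ioo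
  set σ : ℝ → ℝ := fun t ↦ W - (W - w₀) * E.indicator (fun _ ↦ (1 : ℝ)) t with hσ
  have hσ_in : ∀ t ∈ E, σ t = w₀ := fun t ht ↦ by
    simp only [hσ, Set.indicator_of_mem ht]; ring
  have hσ_out : ∀ t ∉ E, σ t = W := fun t ht ↦ by
    simp only [hσ, Set.indicator_of_notMem ht]; ring
  have hle : ∀ t, σ t ≤ reDigammaQuarter t := by
    intro t
    by_cases ht : t ∈ E
    · rw [hσ_in t ht]; exact reDigammaQuarter_zero_le t
    · rw [hσ_out t ht]
      refine reDigammaQuarter_mono ?_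
      simp only [hE, mem_Ioo, not_and_or, not_lt] at ht
      rcases ht with h' | h'
      · calc |h| ≤ -t := by linarith
          _ ≤ |t| := neg_le_abs t
      · exact h'.trans (le_abs_self t)
  have e1 : (fun t ↦ u t * σ t) = fun t ↦ W * u t - (W - w₀) * E.indicator u t := by
    ext t
    by_cases ht : t ∈ E
    · rw [hσ_in t ht, Set.indicator_of_mem ht]; ring
    · rw [hσ_out t ht, Set.indicator_of_notMem ht]; ring
  have hσi : Integrable fun t ↦ u t * σ t := by
    rw [e1]; exact (hui.const_mul W).sub ((hui.indicator hEm).const_mul _)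
  have heval : ∫ t, u t * σ t = W * (∫ t, u t) - (W - w₀) * ∫ t in E, u t := by
    rw [e1, integral_sub (hui.const_mul W) ((hui.indicator hEm).const_mul _),
      integral_const_mul, integral_const_mul, integral_indicator hEm]
  rw [← heval]
  exact integral_mono hσi huR fun t ↦ mul_le_mul_of_nonneg_left (hle t) (hu0 t)

/-- **Low-height transparency, integrated.** `∫_{|t|<|h|} u ≤ δ² h² · 2π ‖g‖₂²`. -/
theorem setIntegral_highDensity_le (hg : IsWeilTest g) (hψ : IsMollifier ψ δ) (h : ℝ) :
    ∫ t in Ioo (-|h|) |h|, highDensity g ψ t ≤ δ ^ 2 * h ^ 2 * (2 * π * weilNorm2Sq g) := by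
  set f : ℝ → ℝ := fun t ↦ ‖weilMellin g (1 / 2 + t * I)‖ ^ 2 with hf
  have hfi : Integrable f := integrable_norm_sq_weilMellin_half_line hg
  have hpt : ∀ t ∈ Ioo (-|h|) |h|, highDensity g ψ t ≤ δ ^ 2 * h ^ 2 * f t := by
    intro t ht
    obtain ⟨-, -, h3⟩ := hψ.mollKernel_half_line_bounds t
    have ht2 : t ^ 2 ≤ h ^ 2 := by
      rw [← sq_abs t, ← sq_abs h]
      have : |t| ≤ |h| := abs_le.2 ⟨ht.1.le, ht.2.le⟩
      exact pow_le_pow_left₀ (abs_nonneg t) this 2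
    unfold highDensity
    have hf0 : 0 ≤ f t := sq_nonneg _
    calc ‖weilMellin g (1 / 2 + t * I)‖ ^ 2 * (1 - ‖weilMellin (mollC ψ) (1 / 2 + t * I)‖ ^ 2)
        ≤ f t * (δ ^ 2 * t ^ 2) := mul_le_mul_of_nonneg_left h3 hf0
      _ ≤ f t * (δ ^ 2 * h ^ 2) := by gcongr
      _ = δ ^ 2 * h ^ 2 * f t := by ring
  calc ∫ t in Ioo (-|h|) |h|, highDensity g ψ t
      ≤ ∫ t in Ioo (-|h|) |h|, δ ^ 2 * h ^ 2 * f t :=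
        setIntegral_mono_on (integrable_highDensity hg hψ).integrableOn
          (hfi.const_mul _).integrableOn measurableSet_Ioo hpt
    _ = δ ^ 2 * h ^ 2 * ∫ t in Ioo (-|h|) |h|, f t := integral_const_mul _ _
    _ ≤ δ ^ 2 * h ^ 2 * ∫ t, f t := by
        refine mul_le_mul_of_nonneg_left ?_ (by positivity)
        exact setIntegral_le_integral hfi (Eventually.of_forall fun t ↦ sq_nonneg _)
    _ = δ ^ 2 * h ^ 2 * (2 * π * weilNorm2Sq g) := by
        rw [hf, integral_norm_sq_weilMellin_half_line hg]

/-- **Archimedean integral.** `Re ∫ Ĝ₂ Re ψ = ∫ u Re ψ`. -/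
theorem weilArchIntegral_highPart_re (hg : IsWeilTest g) (hψ : IsMollifier ψ δ) :
    (weilArchIntegral (highPart g ψ)).re = ∫ t, highDensity g ψ t * reDigammaQuarter t := by
  unfold weilArchIntegral
  have e : (fun t : ℝ ↦ weilMellin (highPart g ψ) (1 / 2 + t * I) *
      ((Complex.digamma (1 / 4 + t / 2 * I)).re : ℂ)) =
      fun t : ℝ ↦ ((highDensity g ψ t * reDigammaQuarter t : ℝ) : ℂ) := by
    funext t
    rw [weilMellin_highPart_half_line hg hψ, reDigammaQuarter]
    push_cast; ring
  rw [e, integral_complex_ofReal, Complex.ofReal_re]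

/-- **The high estimate.** If `log π + 2 S(2a+2δ) ≤ Re ψ(1/4 + ih/2)` then
`Re W(G₂) ≥ -(W_h - ψ(1/4)) δ² h² ‖g‖₂² - 2(e^δ - 1) e^a ‖g‖₁²`. -/
theorem weilFunctional_highPart_re_ge (hg : IsWeilTest g) (hsupp : tsupport g ⊆ Icc (-a) a)
    (hψ : IsMollifier ψ δ) {h : ℝ}
    (hh : Real.log π + 2 * primeSum (2 * a + 2 * δ) ≤ reDigammaQuarter h) :
    -((reDigammaQuarter h - reDigammaQuarter 0) * (δ ^ 2 * h ^ 2) * weilNorm2Sq g)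
        - 2 * (Real.exp δ - 1) * (Real.exp a * weilNorm1 g ^ 2) ≤
      (weilFunctional (highPart g ψ)).re := by
  set G := highPart g ψ with hG
  set M₂ := highMass g ψ with hM₂
  set W := reDigammaQuarter h
  set w₀ := reDigammaQuarter 0
  have hM₂0 : 0 ≤ M₂ := highMass_nonneg hψ g
  have hπ : (0 : ℝ) < 2 * π := by positivity
  -- polar
  have hpol : -(2 * (Real.exp δ - 1) * (Real.exp a * weilNorm1 g ^ 2)) ≤ (weilPolarTerm G).re := by
    have h1 := norm_weilPolarTerm_highPart_le hg hsupp hψ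
    have h2 := neg_le_abs (weilPolarTerm G).re
    have h3 := Complex.abs_re_le_norm (weilPolarTerm G)
    linarith
  -- prime
  have hpri : (weilPrimeTerm G).re ≤ 2 * M₂ * primeSum (2 * a + 2 * δ) := by
    have h1 := norm_weilPrimeTerm_highPart_le hg hsupp hψ
    exact ((Complex.re_le_norm _)).trans h1
  -- arch
  have hstep := integral_mul_reDigammaQuarter_ge_step (fun t ↦ (highDensity_bounds hψ g t).1)
    (integrable_highDensity hg hψ) (integrable_highDensity_mul_reDigammaQuarter hg hψ) h
  have hlow := setIntegral_highDensity_le hg hψ h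
  have hWw : 0 ≤ W - w₀ := by linarith [reDigammaQuarter_zero_le h]
  have hint : ∫ t, highDensity g ψ t = 2 * π * M₂ := by
    rw [hM₂, highMass, ← mul_assoc, mul_inv_cancel₀ hπ.ne', one_mul]
  have harchI : 2 * π * (W * M₂ - (W - w₀) * (δ ^ 2 * h ^ 2) * weilNorm2Sq g) ≤
      (weilArchIntegral G).re := by
    rw [weilArchIntegral_highPart_re hg hψ]
    have : (W - w₀) * (∫ t in Ioo (-|h|) |h|, highDensity g ψ t) ≤
        (W - w₀) * (δ ^ 2 * h ^ 2 * (2 * π * weilNorm2Sq g)) :=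
      mul_le_mul_of_nonneg_left hlow hWw
    rw [hint] at hstep
    linarith
  have hG0 : (G 0 * (Real.log π : ℂ)).re ≤ M₂ * Real.log π := by
    rw [Complex.re_mul_ofReal]
    refine mul_le_mul_of_nonneg_right ?_ (Real.log_nonneg (by linarith [Real.pi_gt_three]))
    exact (Complex.re_le_norm _).trans (norm_highPart_le hg hψ 0)
  have harch : W * M₂ - (W - w₀) * (δ ^ 2 * h ^ 2) * weilNorm2Sq g - M₂ * Real.log π ≤
      (weilArchTerm G).re := by
    unfold weilArchTerm
    rw [Complex.sub_re]
    have e : ((1 / (2 * π) : ℂ) * weilArchIntegral G).re = 1 / (2 * π) * (weilArchIntegral G).re := by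
      have : (1 / (2 * π) : ℂ) = ((1 / (2 * π) : ℝ) : ℂ) := by push_cast; ring
      rw [this, Complex.re_ofReal_mul]
    rw [e]
    have h3 : W * M₂ - (W - w₀) * (δ ^ 2 * h ^ 2) * weilNorm2Sq g ≤
        1 / (2 * π) * (weilArchIntegral G).re := by
      rw [one_div, le_inv_mul_iff₀ hπ]; exact harchI
    linarith
  -- assemble
  have hW : weilFunctional G = weilPolarTerm G - weilPrimeTerm G + weilArchTerm G := rfl
  rw [hW, Complex.add_re, Complex.sub_re]
  have hkey : 0 ≤ M₂ * (W - Real.log π - 2 * primeSum (2 * a + 2 * δ)) :=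
    mul_nonneg hM₂0 (by linarith)
  nlinarith [hpol, hpri, harch, hkey]

end Summit.RiemannHypothesis.RiemannHypothesis.Theorems
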